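import Summits.KontsevichZagierPeriods.KontsevichZagierPeriods.Theses.FermatIsogeny
import Summits.KontsevichZagierPeriods.KontsevichZagierPeriods.Theorems.InverseLandauTateLiftingVolumeFormLift
import Literature.NumberTheory.Transcendental.KZKernelConjectureForms
import Literature.NumberTheory.Transcendental.KZCalculusProofs
import Literature.Barriers.KontsevichZagierPeriods.PeriodEqualityDecidability

/-!
# `FermatSectorComplete` (stmt-KontsevichZagierPeriods-14252), line `birth` — kernel form and
# structure of the crux (lead c8, `--supports`)

Crux 5 of route FermatIsogeny is the RELATIVE COMPLETENESS of the KZ calculus modulo the β-sector: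
for all representations `r r'` of KZ's literal shape with equal value,
`[r] − [r'] ∈ relations ⊔ closure (S_lin ∪ S_prod)`, `S_lin` / `S_prod` the formal differences of
the hypothesis pairs of `BetaLinearSector` / `BetaProductSector`.

This file lands the structural facts every stub of the line is measured against (the analogue,
for this crux, of `CompleteModGammaSectorNegative` of the sibling crux stmt-14233):

* §1 GENERIC: for any subgroup `G ≥ relations`, the rational two-representation form relative to
  `G` ↔ `ker eval ≤ G` (`subgroupForm_iff_ker_le`) ↔ the form for ALL representations
  (`subgroupForm_iff_withoutRational`) ↔ the Cresson–Viu-Sos VOLUME form relative to `G`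
  (`subgroupForm_iff_volumeForm`, over the tree's relative lift
  `InverseLandau.VolumeFormLift.of_sub_of_mem`);
* §2 THE CRUX: `fermatSectorComplete_iff_ker_le`, soundness of the enlarged calculus
  (`betaSector_le_ker_eval`: no junk truth), `of_summit` / `summit_false_of_not`, the crux IS the
  summit once cruxes 3–4 hold (`iff_summit_of_sectors`, the route's `closes` read both ways),
  RESIDUAL ABSORPTION (`fermatSectorComplete_iff_residual`: for every lever `T ≤` β-sector the
  residual "ker eval ≤ β-sector ⊔ T" is the crux again — why sector-cut lines cannot lower it),
  value equality is load-bearing (`fermatSectorComplete_false_without_valueEq`), the rational shape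
  is not (`fermatSectorComplete_iff_withoutRational`), and the volume form of the crux
  (`fermatSectorComplete_iff_volumeForm`) used by the line's composition.

References: Kontsevich–Zagier 2001 §1.2 (Conjecture 1); Cresson–Viu-Sos, JTNB 34 (2022) §1 p. 326;
Viu-Sos, IJNT 17 (2021) Thm 1.1; Huber–Müller-Stach 2017, Conj. 13.2.1.
-/

noncomputable section

open MeasureTheory Set
open scoped BigOperators

namespace Summit.KontsevichZagierPeriods.FermatIsogeny.FermatSectorCompleteKernelForm

open Literature.NumberTheory.Transcendental
open Literature.NumberTheory.Transcendental.KZ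
open Summit.KontsevichZagierPeriods.KontsevichZagierPeriods.Theses.FermatIsogeny
  (FermatSectorComplete BetaLinearSector BetaProductSector closes)
open Literature.Barriers.KontsevichZagierPeriods.KZ (constRep constRep_value constRep_isRational)

/-! ## §1 Generic: the two-representation form relative to a subgroup `G ≥ relations` -/

/-- **Kernel form, relative to a subgroup.** For `relations ≤ G`: "all RATIONAL representations of
equal value differ by an element of `G`" iff `ker eval ≤ G`. (`←`: `eval ([r] − [r']) = 0`;
`→`: write `c ≡ [r] − [r']` modulo relations (`KZ.exists_integralRep_sub_holds`), replace `r, r'`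
by rational-shape equivalents (`KZ.exists_isRational_equivalent_holds`), values agree by soundness.)
[cite: KontsevichZagier2001, §1.2 Conjecture 1] -/
theorem subgroupForm_iff_ker_le (G : AddSubgroup FormalRep) (hG : relations ≤ G) :
    (∀ ⦃n m : ℕ⦄ (r : IntegralRep n) (r' : IntegralRep m),
        r.IsRational → r'.IsRational → r.value = r'.value → of r - of r' ∈ G) ↔ eval.ker ≤ G := by
  constructor
  · intro h c hc
    have hc0 : eval c = 0 := hc
    obtain ⟨n, m, r, r', hrel⟩ := exists_integralRep_sub_holds c
    obtain ⟨N, R, hR, hrR⟩ := exists_isRational_equivalent_holds r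
    obtain ⟨N', R', hR', hrR'⟩ := exists_isRational_equivalent_holds r'
    have hker : eval (c - (of r - of r')) = 0 := relations_le_ker_eval_holds hrel
    rw [map_sub, hc0, zero_sub, neg_eq_zero, eval_of_sub_of, sub_eq_zero] at hker
    have hv : R.value = R'.value := by
      rw [← Equivalent.value_eq_holds hrR, ← Equivalent.value_eq_holds hrR', hker]
    have hRR' : of R - of R' ∈ G := h R R' hR hR' hv
    have h1 : of r - of R ∈ G := hG hrR
    have h2 : of R' - of r' ∈ G := hG hrR'.symm
    have h3 : c - (of r - of r') ∈ G := hG hrel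
    have hc' : c = (c - (of r - of r')) + ((of r - of R) + (of R - of R') + (of R' - of r')) := by
      abel
    rw [hc']
    exact G.add_mem h3 (G.add_mem (G.add_mem h1 hRR') h2)
  · intro h n m r r' _ _ hv
    apply h
    show eval (of r - of r') = 0
    rw [eval_of_sub_of, hv, sub_self]

/-- **The rational shape is not load-bearing**, relative to any `G ≥ relations`: the rational
two-representation form is equivalent to the form for ALL (`ℚ`-semialgebraic) representations.
[cite: KontsevichZagier2001, §1.1 remark after the Definition] -/
theorem subgroupForm_iff_withoutRational (G : AddSubgroup FormalRep) (hG : relations ≤ G) :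
    (∀ ⦃n m : ℕ⦄ (r : IntegralRep n) (r' : IntegralRep m),
        r.IsRational → r'.IsRational → r.value = r'.value → of r - of r' ∈ G) ↔
      ∀ ⦃n m : ℕ⦄ (r : IntegralRep n) (r' : IntegralRep m), r.value = r'.value → of r - of r' ∈ G :=
  ⟨fun h _ _ r r' hv => (subgroupForm_iff_ker_le G hG).mp h
      (show eval (of r - of r') = 0 by rw [eval_of_sub_of, hv, sub_self]),
    fun h _ _ r r' _ _ hv => h r r' hv⟩

/-- **Volume form, relative to a subgroup** (Cresson–Viu-Sos over the tree's discharged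
semi-canonical reduction): for `relations ≤ G`, the rational two-representation form relative to
`G` is equivalent to "two representations of ONE dimension with compact domains of non-empty
interior, integrand `1` and equal value differ by an element of `G`". `→`: integrand-`1` bodies are
of literal shape; `←`: `InverseLandau.VolumeFormLift.of_sub_of_mem`.
[cite: CressonViusos2022, §1 p. 326] -/
theorem subgroupForm_iff_volumeForm (G : AddSubgroup FormalRep) (hG : relations ≤ G) :
    (∀ ⦃n m : ℕ⦄ (r : IntegralRep n) (r' : IntegralRep m),
        r.IsRational → r'.IsRational → r.value = r'.value → of r - of r' ∈ G) ↔
      ∀ (d : ℕ) (K K' : IntegralRep d), IsCompact K.domain → (interior K.domain).Nonempty →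
        IsCompact K'.domain → (interior K'.domain).Nonempty →
        (∀ x ∈ K.domain, K.integrand x = 1) → (∀ x ∈ K'.domain, K'.integrand x = 1) →
        K.value = K'.value → of K - of K' ∈ G := by
  constructor
  · intro h d K K' _ _ _ _ hK1 hK'1 hv
    -- integrand-`1` bodies have KZ's literal shape (`p = q = 1`); inlined (the named lemma exists in
    -- `SymplecticScissors.OffPlaneSplit.isRational_of_integrand_one`, a heavy import)
    exact h K K' ⟨1, 1, fun x _ => by simp, fun x hx => by simp [hK1 x hx]⟩
      ⟨1, 1, fun x _ => by simp, fun x hx => by simp [hK'1 x hx]⟩ hv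
  · intro h n m r r' _ _ hv
    exact Summit.KontsevichZagierPeriods.InverseLandau.VolumeFormLift.of_sub_of_mem G hG h r r' hv

/-! ## §2 The crux: kernel form, soundness, position relative to the summit -/

/-- **Kernel form of the crux**: `FermatSectorComplete ↔ ker eval ≤ relations ⊔ closure (S_lin ∪ S_prod)`.
A refutation is therefore exactly an additive invariant of `FormalRep` killing the four move sets
and the β-pairs and not factoring through `eval`. [cite: KontsevichZagier2001, §1.2 Conjecture 1] -/
theorem fermatSectorComplete_iff_ker_le :
    Summit.KontsevichZagierPeriods.KontsevichZagierPeriods.Theses.FermatIsogeny.FermatSectorComplete ↔ Literature.NumberTheory.Transcendental.KZ.eval.ker ≤ Literature.NumberTheory.Transcendental.KZ.relations ⊔ AddSubgroup.closure ({z : Literature.NumberTheory.Transcendental.KZ.FormalRep | ∃ (a b a' b' : ℚ) (c : ℝ) (ρ ρ' : Literature.NumberTheory.Transcendental.KZ.IntegralRep 1), 0 < a ∧ 0 < b ∧ 0 < a' ∧ 0 < b' ∧ IsAlgebraic ℚ c ∧ ρ.domain = {x | x 0 ∈ Set.Ioo (0:ℝ) 1} ∧ Set.EqOn ρ.integrand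 (fun x => (x 0) ^ ((a:ℝ) - 1) * (1 - x 0) ^ ((b:ℝ) - 1)) ρ.domain ∧ ρ'.domain = {x | x 0 ∈ Set.Ioo (0:ℝ) 1} ∧ Set.EqOn ρ'.integrand (fun x => c * (x 0) ^ ((a':ℝ) - 1) * (1 - x 0) ^ ((b':ℝ) - 1)) ρ'.domain ∧ ρ.value = ρ'.value ∧ z = Literature.NumberTheory.Transcendental.KZ.of ρ - Literature.NumberTheory.Transcendental.KZ.of ρ'} ∪ {z : Literature.NumberTheory.Transcendental.KZ.FormalRep | ∃ (a b e d a' b' e' d' : ℚ) (q : ℝ) (ρ ρ' : Literature.NumberTheory.Transcendental.KZ.IntegralRep 2), 0 < a ∧ 0 < b ∧ 0 < e ∧ 0 < d ∧ 0 < a' ∧ 0 < b' ∧ 0 < e' ∧ 0 < d' ∧ IsAlgebraic ℚ q ∧ ρ.domain = {x | ∀ i, x i ∈ Set.Ioo (0:ℝ) 1} ∧ Set.EqOn ρ.integrand (fun x => (x 0) ^ ((a:ℝ) - 1) * (1 - x 0) ^ ((b:ℝ) - 1) * (x 1) ^ ((e:ℝ) - 1) * (1 - x 1) ^ ((d:ℝ)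 - 1)) ρ.domain ∧ ρ'.domain = {x | ∀ i, x i ∈ Set.Ioo (0:ℝ) 1} ∧ Set.EqOn ρ'.integrand (fun x => q * (x 0) ^ ((a':ℝ) - 1) * (1 - x 0) ^ ((b':ℝ) - 1) * (x 1) ^ ((e':ℝ) - 1) * (1 - x 1) ^ ((d':ℝ) - 1)) ρ'.domain ∧ ρ.value = ρ'.value ∧ z = Literature.NumberTheory.Transcendental.KZ.of ρ - Literature.NumberTheory.Transcendental.KZ.of ρ'}) :=
  subgroupForm_iff_ker_le _ le_sup_left

/-- **Soundness of the enlarged calculus (no junk truth)**: the β-sector subgroup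
`relations ⊔ closure (S_lin ∪ S_prod)` lies in `ker eval` — relations by soundness of the moves
(`KZ.relations_le_ker_eval_holds`), each β-pair by its value conjunct.
[cite: KontsevichZagier2001, §1.2] -/
theorem betaSector_le_ker_eval :
    Literature.NumberTheory.Transcendental.KZ.relations ⊔ AddSubgroup.closure ({z : Literature.NumberTheory.Transcendental.KZ.FormalRep | ∃ (a b a' b' : ℚ) (c : ℝ) (ρ ρ' : Literature.NumberTheory.Transcendental.KZ.IntegralRep 1), 0 < a ∧ 0 < b ∧ 0 < a' ∧ 0 < b' ∧ IsAlgebraic ℚ c ∧ ρ.domain = {x | x 0 ∈ Set.Ioo (0:ℝ) 1} ∧ Set.EqOn ρ.integrand (fun x => (x 0) ^ ((a:ℝ) - 1) * (1 - x 0) ^ ((b:ℝ) - 1)) ρ.domain ∧ ρ'.domain = {x | x 0 ∈ Set.Ioo (0:ℝ) 1} ∧ Set.EqOn ρ'.integrand (fun x => c * (x 0) ^ ((a':ℝ) - 1) * (1 - x 0) ^ ((b':ℝ) - 1)) ρ'.domain ∧ ρ.value = ρ'.value ∧ z = Literature.NumberTheory.Transcendental.KZ.of ρ - Literature.NumberTheory.Transcendental.KZ.of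 ρ'} ∪ {z : Literature.NumberTheory.Transcendental.KZ.FormalRep | ∃ (a b e d a' b' e' d' : ℚ) (q : ℝ) (ρ ρ' : Literature.NumberTheory.Transcendental.KZ.IntegralRep 2), 0 < a ∧ 0 < b ∧ 0 < e ∧ 0 < d ∧ 0 < a' ∧ 0 < b' ∧ 0 < e' ∧ 0 < d' ∧ IsAlgebraic ℚ q ∧ ρ.domain = {x | ∀ i, x i ∈ Set.Ioo (0:ℝ) 1} ∧ Set.EqOn ρ.integrand (fun x => (x 0) ^ ((a:ℝ) - 1) * (1 - x 0) ^ ((b:ℝ) - 1) * (x 1) ^ ((e:ℝ) - 1) * (1 - x 1) ^ ((d:ℝ) - 1)) ρ.domain ∧ ρ'.domain = {x | ∀ i, x i ∈ Set.Ioo (0:ℝ) 1} ∧ Set.EqOn ρ'.integrand (fun x => q * (x 0) ^ ((a':ℝ) - 1) * (1 - x 0) ^ ((b':ℝ) - 1) * (x 1) ^ ((e':ℝ) - 1) * (1 - x 1) ^ ((d':ℝ) - 1)) ρ'.domain ∧ ρ.value = ρ'.value ∧ z = Literature.NumberTheory.Transcendental.KZ.of ρ - Literature.NumberTheory.Transcendental.KZ.of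 ρ'}) ≤ eval.ker := by
  refine sup_le relations_le_ker_eval_holds ((AddSubgroup.closure_le _).mpr ?_)
  rintro z (⟨a, b, a', b', c, ρ, ρ', -, -, -, -, -, -, -, -, -, hval, rfl⟩ |
    ⟨a, b, e, d, a', b', e', d', q, ρ, ρ', -, -, -, -, -, -, -, -, -, -, -, -, -, hval, rfl⟩)
  · show eval (of ρ - of ρ') = 0
    rw [eval_of_sub_of, hval, sub_self]
  · show eval (of ρ - of ρ') = 0
    rw [eval_of_sub_of, hval, sub_self]

/-- **The summit implies the crux** (`relations ≤ relations ⊔ _`): the crux is never stronger than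
Kontsevich–Zagier's Conjecture 1 as formalised. [cite: KontsevichZagier2001, §1.2 Conjecture 1] -/
theorem of_summit (h : KontsevichZagierPeriods) : FermatSectorComplete :=
  fun _ _ r r' hr hr' hv => AddSubgroup.mem_sup_left (h r r' hr hr' hv)

/-- Contrapositive: a refutation of the crux refutes the summit as formalised (off the β-sector).
[folklore] -/
theorem summit_false_of_not (h : ¬ FermatSectorComplete) : ¬ KontsevichZagierPeriods :=
  fun hs => h (of_summit hs)

/-- **Given the β-sector cruxes 3–4, the crux IS the summit** (the route's deciding theorem
`closes`, read both ways). [folklore] -/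
theorem iff_summit_of_sectors (h₃ : BetaLinearSector) (h₄ : BetaProductSector) :
    FermatSectorComplete ↔ KontsevichZagierPeriods :=
  ⟨fun h => closes h₃ h₄ h, of_summit⟩

/-- Under cruxes 3–4 the β-sector subgroup collapses to the moves:
`relations ⊔ closure (S_lin ∪ S_prod) = relations`. [folklore] -/
theorem betaSector_eq_relations_of_sectors (h₃ : BetaLinearSector) (h₄ : BetaProductSector) :
    Literature.NumberTheory.Transcendental.KZ.relations ⊔ AddSubgroup.closure ({z : Literature.NumberTheory.Transcendental.KZ.FormalRep | ∃ (a b a' b' : ℚ) (c : ℝ) (ρ ρ' : Literature.NumberTheory.Transcendental.KZ.IntegralRep 1), 0 < a ∧ 0 < b ∧ 0 < a' ∧ 0 < b' ∧ IsAlgebraic ℚ c ∧ ρ.domain = {x | x 0 ∈ Set.Ioo (0:ℝ) 1} ∧ Set.EqOn ρ.integrand (fun x => (x 0) ^ ((a:ℝ) - 1) * (1 - x 0) ^ ((b:ℝ) - 1)) ρ.domain ∧ ρ'.domain = {x | x 0 ∈ Set.Ioo (0:ℝ) 1} ∧ Set.EqOn ρ'.integrand (fun x => c * (x 0) ^ ((a':ℝ)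 - 1) * (1 - x 0) ^ ((b':ℝ) - 1)) ρ'.domain ∧ ρ.value = ρ'.value ∧ z = Literature.NumberTheory.Transcendental.KZ.of ρ - Literature.NumberTheory.Transcendental.KZ.of ρ'} ∪ {z : Literature.NumberTheory.Transcendental.KZ.FormalRep | ∃ (a b e d a' b' e' d' : ℚ) (q : ℝ) (ρ ρ' : Literature.NumberTheory.Transcendental.KZ.IntegralRep 2), 0 < a ∧ 0 < b ∧ 0 < e ∧ 0 < d ∧ 0 < a' ∧ 0 < b' ∧ 0 < e' ∧ 0 < d' ∧ IsAlgebraic ℚ q ∧ ρ.domain = {x | ∀ i, x i ∈ Set.Ioo (0:ℝ) 1} ∧ Set.EqOn ρ.integrand (fun x => (x 0) ^ ((a:ℝ) - 1) * (1 - x 0) ^ ((b:ℝ) - 1) * (x 1) ^ ((e:ℝ) - 1) * (1 - x 1) ^ ((d:ℝ) - 1)) ρ.domain ∧ ρ'.domain = {x | ∀ i, x i ∈ Set.Ioo (0:ℝ) 1} ∧ Set.EqOn ρ'.integrand (fun x => q * (x 0) ^ ((a':ℝ) - 1) * (1 - x 0) ^ ((b':ℝ) - 1) * (x 1) ^ ((e':ℝ)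 - 1) * (1 - x 1) ^ ((d':ℝ) - 1)) ρ'.domain ∧ ρ.value = ρ'.value ∧ z = Literature.NumberTheory.Transcendental.KZ.of ρ - Literature.NumberTheory.Transcendental.KZ.of ρ'}) = Literature.NumberTheory.Transcendental.KZ.relations := by
  refine le_antisymm (sup_le le_rfl ((AddSubgroup.closure_le _).mpr ?_)) le_sup_left
  rintro z (⟨a, b, a', b', c, ρ, ρ', ha, hb, ha', hb', hc, hd, hi, hd', hi', hval, rfl⟩ |
    ⟨a, b, e, d, a', b', e', d', q, ρ, ρ', ha, hb, he, hdd, ha', hb', he', hd'', hq, hd, hi, hd', hi', hval, rfl⟩)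
  · exact h₃ a b a' b' c ha hb ha' hb' hc ρ ρ' hd hi hd' hi' hval
  · exact h₄ a b e d a' b' e' d' q ha hb he hdd ha' hb' he' hd'' hq ρ ρ' hd hi hd' hi' hval

/-- **Residual absorption.** For every lever `T` already inside the β-sector subgroup (a set of
identities proved by the moves, possibly using the β-pairs), the "residual" statement
`ker eval ≤ β-sector ⊔ T` is the crux again: a line of the shape (lever ≤ sector) + (residual)
cannot lower this crux. [folklore] -/
theorem fermatSectorComplete_iff_residual (T : AddSubgroup FormalRep)
    (hT : T ≤ Literature.NumberTheory.Transcendental.KZ.relations ⊔ AddSubgroup.closure ({z : Literature.NumberTheory.Transcendental.KZ.FormalRep | ∃ (a b a' b' : ℚ) (c : ℝ) (ρ ρ' : Literature.NumberTheory.Transcendental.KZ.IntegralRep 1), 0 < a ∧ 0 < b ∧ 0 < a' ∧ 0 < b' ∧ IsAlgebraic ℚ c ∧ ρ.domain = {x | x 0 ∈ Set.Ioo (0:ℝ) 1} ∧ Set.EqOn ρ.integrand (fun x => (x 0) ^ ((a:ℝ) - 1) * (1 - x 0) ^ ((b:ℝ) - 1)) ρ.domain ∧ ρ'.domain = {x |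 x 0 ∈ Set.Ioo (0:ℝ) 1} ∧ Set.EqOn ρ'.integrand (fun x => c * (x 0) ^ ((a':ℝ) - 1) * (1 - x 0) ^ ((b':ℝ) - 1)) ρ'.domain ∧ ρ.value = ρ'.value ∧ z = Literature.NumberTheory.Transcendental.KZ.of ρ - Literature.NumberTheory.Transcendental.KZ.of ρ'} ∪ {z : Literature.NumberTheory.Transcendental.KZ.FormalRep | ∃ (a b e d a' b' e' d' : ℚ) (q : ℝ) (ρ ρ' : Literature.NumberTheory.Transcendental.KZ.IntegralRep 2), 0 < a ∧ 0 < b ∧ 0 < e ∧ 0 < d ∧ 0 < a' ∧ 0 < b' ∧ 0 < e' ∧ 0 < d' ∧ IsAlgebraic ℚ q ∧ ρ.domain = {x | ∀ i, x i ∈ Set.Ioo (0:ℝ) 1} ∧ Set.EqOn ρ.integrand (fun x => (x 0) ^ ((a:ℝ) - 1) * (1 - x 0) ^ ((b:ℝ) - 1) * (x 1) ^ ((e:ℝ) - 1) * (1 - x 1) ^ ((d:ℝ) - 1)) ρ.domain ∧ ρ'.domain = {x | ∀ i, x i ∈ Set.Ioo (0:ℝ) 1} ∧ Set.EqOn ρ'.integrand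 (fun x => q * (x 0) ^ ((a':ℝ) - 1) * (1 - x 0) ^ ((b':ℝ) - 1) * (x 1) ^ ((e':ℝ) - 1) * (1 - x 1) ^ ((d':ℝ) - 1)) ρ'.domain ∧ ρ.value = ρ'.value ∧ z = Literature.NumberTheory.Transcendental.KZ.of ρ - Literature.NumberTheory.Transcendental.KZ.of ρ'})) :
    FermatSectorComplete ↔ eval.ker ≤ (Literature.NumberTheory.Transcendental.KZ.relations ⊔ AddSubgroup.closure ({z : Literature.NumberTheory.Transcendental.KZ.FormalRep | ∃ (a b a' b' : ℚ) (c : ℝ) (ρ ρ' : Literature.NumberTheory.Transcendental.KZ.IntegralRep 1), 0 < a ∧ 0 < b ∧ 0 < a' ∧ 0 < b' ∧ IsAlgebraic ℚ c ∧ ρ.domain = {x | x 0 ∈ Set.Ioo (0:ℝ) 1} ∧ Set.EqOn ρ.integrand (fun x => (x 0) ^ ((a:ℝ) - 1) * (1 - x 0) ^ ((b:ℝ) - 1)) ρ.domain ∧ ρ'.domain = {x | x 0 ∈ Set.Ioo (0:ℝ) 1} ∧ Set.EqOn ρ'.integrand (fun x => c * (x 0) ^ ((a':ℝ) - 1) *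 (1 - x 0) ^ ((b':ℝ) - 1)) ρ'.domain ∧ ρ.value = ρ'.value ∧ z = Literature.NumberTheory.Transcendental.KZ.of ρ - Literature.NumberTheory.Transcendental.KZ.of ρ'} ∪ {z : Literature.NumberTheory.Transcendental.KZ.FormalRep | ∃ (a b e d a' b' e' d' : ℚ) (q : ℝ) (ρ ρ' : Literature.NumberTheory.Transcendental.KZ.IntegralRep 2), 0 < a ∧ 0 < b ∧ 0 < e ∧ 0 < d ∧ 0 < a' ∧ 0 < b' ∧ 0 < e' ∧ 0 < d' ∧ IsAlgebraic ℚ q ∧ ρ.domain = {x | ∀ i, x i ∈ Set.Ioo (0:ℝ) 1} ∧ Set.EqOn ρ.integrand (fun x => (x 0) ^ ((a:ℝ) - 1) * (1 - x 0) ^ ((b:ℝ) - 1) * (x 1) ^ ((e:ℝ) - 1) * (1 - x 1) ^ ((d:ℝ) - 1)) ρ.domain ∧ ρ'.domain = {x | ∀ i, x i ∈ Set.Ioo (0:ℝ) 1} ∧ Set.EqOn ρ'.integrand (fun x => q * (x 0) ^ ((a':ℝ) - 1) * (1 - x 0) ^ ((b':ℝ) - 1) * (x 1) ^ ((e':ℝ)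 - 1) * (1 - x 1) ^ ((d':ℝ) - 1)) ρ'.domain ∧ ρ.value = ρ'.value ∧ z = Literature.NumberTheory.Transcendental.KZ.of ρ - Literature.NumberTheory.Transcendental.KZ.of ρ'})) ⊔ T := by
  rw [sup_eq_left.mpr hT]
  exact fermatSectorComplete_iff_ker_le

/-- **Value equality is load-bearing**: `[pt, 1]` and `[pt, 2]` have KZ's literal shape and
`[pt,1] − [pt,2]` is not in the β-sector subgroup, which evaluates to `0` while `1 − 2 ≠ 0`.
[folklore] -/
theorem fermatSectorComplete_false_without_valueEq :
    ¬ (∀ ⦃n m : ℕ⦄ (r : IntegralRep n) (r' : IntegralRep m), r.IsRational → r'.IsRational →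
        of r - of r' ∈ Literature.NumberTheory.Transcendental.KZ.relations ⊔ AddSubgroup.closure ({z : Literature.NumberTheory.Transcendental.KZ.FormalRep | ∃ (a b a' b' : ℚ) (c : ℝ) (ρ ρ' : Literature.NumberTheory.Transcendental.KZ.IntegralRep 1), 0 < a ∧ 0 < b ∧ 0 < a' ∧ 0 < b' ∧ IsAlgebraic ℚ c ∧ ρ.domain = {x | x 0 ∈ Set.Ioo (0:ℝ) 1} ∧ Set.EqOn ρ.integrand (fun x => (x 0) ^ ((a:ℝ) - 1) * (1 - x 0) ^ ((b:ℝ) - 1)) ρ.domain ∧ ρ'.domain = {x | x 0 ∈ Set.Ioo (0:ℝ) 1} ∧ Set.EqOn ρ'.integrand (fun x => c * (x 0) ^ ((a':ℝ) - 1) * (1 - x 0) ^ ((b':ℝ) - 1)) ρ'.domain ∧ ρ.value = ρ'.value ∧ z = Literature.NumberTheory.Transcendental.KZ.of ρ - Literature.NumberTheory.Transcendental.KZ.of ρ'} ∪ {z : Literature.NumberTheory.Transcendental.KZ.FormalRep | ∃ (a b e d a' b' e' d' : ℚ) (q : ℝ) (ρ ρ' : Literature.NumberTheory.Transcendental.KZ.IntegralRep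 2), 0 < a ∧ 0 < b ∧ 0 < e ∧ 0 < d ∧ 0 < a' ∧ 0 < b' ∧ 0 < e' ∧ 0 < d' ∧ IsAlgebraic ℚ q ∧ ρ.domain = {x | ∀ i, x i ∈ Set.Ioo (0:ℝ) 1} ∧ Set.EqOn ρ.integrand (fun x => (x 0) ^ ((a:ℝ) - 1) * (1 - x 0) ^ ((b:ℝ) - 1) * (x 1) ^ ((e:ℝ) - 1) * (1 - x 1) ^ ((d:ℝ) - 1)) ρ.domain ∧ ρ'.domain = {x | ∀ i, x i ∈ Set.Ioo (0:ℝ) 1} ∧ Set.EqOn ρ'.integrand (fun x => q * (x 0) ^ ((a':ℝ) - 1) * (1 - x 0) ^ ((b':ℝ) - 1) * (x 1) ^ ((e':ℝ) - 1) * (1 - x 1) ^ ((d':ℝ) - 1)) ρ'.domain ∧ ρ.value = ρ'.value ∧ z = Literature.NumberTheory.Transcendental.KZ.of ρ - Literature.NumberTheory.Transcendental.KZ.of ρ'})) := by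
  intro h
  have h0 := betaSector_le_ker_eval
    (h (constRep 1) (constRep 2) (constRep_isRational 1) (constRep_isRational 2))
  rw [AddMonoidHom.mem_ker, eval_of_sub_of, constRep_value, constRep_value] at h0
  norm_num at h0

/-- **The rational shape is NOT load-bearing**: the crux is equivalent to its version for ALL
(`ℚ`-semialgebraic) representations. [cite: KontsevichZagier2001, §1.1 remark after the Definition] -/
theorem fermatSectorComplete_iff_withoutRational :
    FermatSectorComplete ↔
      ∀ ⦃n m : ℕ⦄ (r : IntegralRep n) (r' : IntegralRep m), r.value = r'.value →
        of r - of r' ∈ Literature.NumberTheory.Transcendental.KZ.relations ⊔ AddSubgroup.closure ({z : Literature.NumberTheory.Transcendental.KZ.FormalRep | ∃ (a b a' b' : ℚ) (c : ℝ) (ρ ρ' : Literature.NumberTheory.Transcendental.KZ.IntegralRep 1), 0 < a ∧ 0 < b ∧ 0 < a' ∧ 0 < b' ∧ IsAlgebraic ℚ c ∧ ρ.domain = {x | x 0 ∈ Set.Ioo (0:ℝ) 1} ∧ Set.EqOn ρ.integrand (fun x => (x 0) ^ ((a:ℝ) - 1) * (1 - x 0) ^ ((b:ℝ) - 1)) ρ.domain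 ∧ ρ'.domain = {x | x 0 ∈ Set.Ioo (0:ℝ) 1} ∧ Set.EqOn ρ'.integrand (fun x => c * (x 0) ^ ((a':ℝ) - 1) * (1 - x 0) ^ ((b':ℝ) - 1)) ρ'.domain ∧ ρ.value = ρ'.value ∧ z = Literature.NumberTheory.Transcendental.KZ.of ρ - Literature.NumberTheory.Transcendental.KZ.of ρ'} ∪ {z : Literature.NumberTheory.Transcendental.KZ.FormalRep | ∃ (a b e d a' b' e' d' : ℚ) (q : ℝ) (ρ ρ' : Literature.NumberTheory.Transcendental.KZ.IntegralRep 2), 0 < a ∧ 0 < b ∧ 0 < e ∧ 0 < d ∧ 0 < a' ∧ 0 < b' ∧ 0 < e' ∧ 0 < d' ∧ IsAlgebraic ℚ q ∧ ρ.domain = {x | ∀ i, x i ∈ Set.Ioo (0:ℝ) 1} ∧ Set.EqOn ρ.integrand (fun x => (x 0) ^ ((a:ℝ) - 1) * (1 - x 0) ^ ((b:ℝ) - 1) * (x 1) ^ ((e:ℝ) - 1) * (1 - x 1) ^ ((d:ℝ) - 1)) ρ.domain ∧ ρ'.domain = {x | ∀ i, x i ∈ Set.Ioo (0:ℝ) 1}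 ∧ Set.EqOn ρ'.integrand (fun x => q * (x 0) ^ ((a':ℝ) - 1) * (1 - x 0) ^ ((b':ℝ) - 1) * (x 1) ^ ((e':ℝ) - 1) * (1 - x 1) ^ ((d':ℝ) - 1)) ρ'.domain ∧ ρ.value = ρ'.value ∧ z = Literature.NumberTheory.Transcendental.KZ.of ρ - Literature.NumberTheory.Transcendental.KZ.of ρ'}) :=
  subgroupForm_iff_withoutRational _ le_sup_left

/-- **Volume form of the crux** (the shape the line's composition uses): `FermatSectorComplete` iff
two representations of one dimension with compact domains of non-empty interior, integrand `1` and
equal value differ by an element of the β-sector subgroup. [cite: CressonViusos2022, §1 p. 326] -/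
theorem fermatSectorComplete_iff_volumeForm :
    FermatSectorComplete ↔
      ∀ (d : ℕ) (K K' : IntegralRep d), IsCompact K.domain → (interior K.domain).Nonempty →
        IsCompact K'.domain → (interior K'.domain).Nonempty →
        (∀ x ∈ K.domain, K.integrand x = 1) → (∀ x ∈ K'.domain, K'.integrand x = 1) →
        K.value = K'.value →
        of K - of K' ∈ Literature.NumberTheory.Transcendental.KZ.relations ⊔ AddSubgroup.closure ({z : Literature.NumberTheory.Transcendental.KZ.FormalRep | ∃ (a b a' b' : ℚ) (c : ℝ) (ρ ρ' : Literature.NumberTheory.Transcendental.KZ.IntegralRep 1), 0 < a ∧ 0 < b ∧ 0 < a' ∧ 0 < b' ∧ IsAlgebraic ℚ c ∧ ρ.domain = {x | x 0 ∈ Set.Ioo (0:ℝ) 1} ∧ Set.EqOn ρ.integrand (fun x => (x 0) ^ ((a:ℝ) - 1) * (1 - x 0) ^ ((b:ℝ) - 1)) ρ.domain ∧ ρ'.domain = {x | x 0 ∈ Set.Ioo (0:ℝ) 1} ∧ Set.EqOn ρ'.integrand (fun x => c * (x 0) ^ ((a':ℝ) - 1) * (1 - x 0) ^ ((b':ℝ)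 - 1)) ρ'.domain ∧ ρ.value = ρ'.value ∧ z = Literature.NumberTheory.Transcendental.KZ.of ρ - Literature.NumberTheory.Transcendental.KZ.of ρ'} ∪ {z : Literature.NumberTheory.Transcendental.KZ.FormalRep | ∃ (a b e d a' b' e' d' : ℚ) (q : ℝ) (ρ ρ' : Literature.NumberTheory.Transcendental.KZ.IntegralRep 2), 0 < a ∧ 0 < b ∧ 0 < e ∧ 0 < d ∧ 0 < a' ∧ 0 < b' ∧ 0 < e' ∧ 0 < d' ∧ IsAlgebraic ℚ q ∧ ρ.domain = {x | ∀ i, x i ∈ Set.Ioo (0:ℝ) 1} ∧ Set.EqOn ρ.integrand (fun x => (x 0) ^ ((a:ℝ) - 1) * (1 - x 0) ^ ((b:ℝ) - 1) * (x 1) ^ ((e:ℝ) - 1) * (1 - x 1) ^ ((d:ℝ) - 1)) ρ.domain ∧ ρ'.domain = {x | ∀ i, x i ∈ Set.Ioo (0:ℝ) 1} ∧ Set.EqOn ρ'.integrand (fun x => q * (x 0) ^ ((a':ℝ) - 1) * (1 - x 0) ^ ((b':ℝ) - 1) * (x 1) ^ ((e':ℝ) - 1) * (1 - x 1) ^ ((d':ℝ)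 - 1)) ρ'.domain ∧ ρ.value = ρ'.value ∧ z = Literature.NumberTheory.Transcendental.KZ.of ρ - Literature.NumberTheory.Transcendental.KZ.of ρ'}) :=
  subgroupForm_iff_volumeForm _ le_sup_left

end Summit.KontsevichZagierPeriods.FermatIsogeny.FermatSectorCompleteKernelForm

end
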